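import Summits.QuantumFields.BalabanUV.Beta.GAN24.DirichletVertexDistV
import Summits.QuantumFields.BalabanUV.Beta.GAN24.DirichletBoxWeightedTraces

/-!
# `BalabanUV.Beta.GAN24.DirichletVertexFlux` — binder row G-an2-4 / (CONV-C), road P2 PART IV, leaf L14 (the torus transfer), FILE C6b:
# THE FLUX BINDERS (Φ) AND (Φ′) FROM WEIGHTED ONE-LEVEL QUANTITIES — the explicit ray schedule (unit b2b-balaban-gan24-p2, gen 27, v1)

HONEST FRAMING (cell contract, verbatim): «discharging `BetaPertH` makes Bałaban's UV stability UNCONDITIONAL — a real constructive-QFT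
result; it is NOT the continuum limit and NOT the Clay problem.»  SUPPLIER module under the T⁴-DAG sub-row `T4-U1a.S-NE2-D1-DIRICHLET°`
(owner wording R24 «the full rate L⁻¹ beyond boxes OPEN»).  The weighted socket `DirichletBoxWeightedSockets.injected_le_of_weighted` (p234489)
displays the flux binders (Φ) `Σ_μ nsq(bdryPart(∂_μ u_f)) ≤ φ‖f‖²` (coarse) and (Φ′) `Σ_μ Σ_{x∉Ω′}|∂′ᴴ_μ∂′_μ v_w|² ≤ φ′‖w‖²` (fine).  The weighted
trace bounds of `DirichletBoxWeightedTraces` (p236313) reduce both to weighted one-level sums, GIVEN a ray schedule.  THIS FILE supplies the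
schedule, for `Ω = blockReg n M S` (d = 2) and the coarse weight `ω_V` of `DirichletVertexEnergy` (p244737), V ANY finite family of vertices:
`ℓ(y) = max(1, ⌊r_V(y)/4⌋)`, `ρ₁ = (18/n)·ω_V⁻¹`, `ρ₂ = ((1+|V|)/n)·ω_V` — the four ray inequalities follow from the integer comparison
`n/r_V ≤ ω_V⁻¹ ≤ (1+|V|)·n/r_V` and the 1-Lipschitz property of `r_V` (`DirichletVertexDistV`, p246485) — and derives, for EVERY `u` vanishing
off `Ω`: (Φ)_field `Σ_μ nsq(bdryPart(∂_μu)) ≤ (36/n)·Σ_μΣ_y ω_V⁻¹|∂_μu|² + (2(1+|V|)/n)·Σ_μΣ_{x∈Ω} ω_V|∂ᴴ_μ∂_μu|²`, and at a refined level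
`n′ = R·N`: (Φ′)_field `Σ_μ Σ_{x∉Ω′}|∂′ᴴ_μ∂′_μv|² ≤ 4n′·(18·Σ_μΣ ω⁻¹|∂′_μv|² + (1+|V|)·Σ_μΣ_{Ω′} ω|∂′ᴴ_μ∂′_μv|²)`.  The weighted sums are
binder (B) (p244737, field form in the END file) and the dominated Hessian (A_ω) (`DirichletVertexDomSum`).

## Contents ([folklore]; 0 sorry)
* §1 `ell`, `rho1`, `rho2`; the schedule lemmas; **`flux_le`**: forward + backward flux of direction `μ`
  `≤ (36/n)·Σ_x ω⁻¹|∂_μu|² + (2(1+|V|)/n)·Σ_{x∈Ω} ω|∂ᴴ_μ∂_μu|²`.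
* §2 **`bdry_sum_le`** = (Φ)_field; §3 `exterior_le_fluxes`, **`exterior_sum_le`** = (Φ′)_field at level `R·N`.

ABSOLUTE RULE (cell, verbatim): «No internally-minted statement may enter as a cited fact. Every hypothesis is either kernel-proved in
this package or a verbatim quotation of a PUBLISHED theorem with page reference. The manuscript(s) under audit are NOT citable for
their own disputed steps — they are the thing under adjudication; programme-internal (2001/route/tribunal) claims are never citable.»
Nothing printed is a hypothesis.  NOT CLAIMED: (A′)/(B) themselves, the END (p234489 stays CONDITIONAL); NOT NE2, (CONV-C), `BetaPertH`,
continuum, Clay.  «not in print; our proof attempt».  HONEST DEPENDENCY: continuum YM on T⁴ ⇐ BetaPertH ∧ nine spine estimates (0/9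
proved); BetaPertH ⇐ (D1) ∧ (D4) ∧ CAP+tail; G-an2-4 gates asym, D1 and NE2/3/4.
-/

noncomputable section

open scoped BigOperators ComplexConjugate Matrix
open Finset

namespace Summit.QuantumFields.BalabanUV.Beta.GAN24.DirichletVertexFlux

open Literature.MathematicalPhysics.QuantumFieldTheory.Balaban1983to89.B5Prop11Plancherel (Tor fine unitVec)
open Literature.MathematicalPhysics.QuantumFieldTheory.Balaban1983to89.B5Action121 (sdiff)
open Literature.MathematicalPhysics.QuantumFieldTheory.Balaban1983to89.B5Prop11Lower (nsq nsq_nonneg)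
open Literature.MathematicalPhysics.QuantumFieldTheory.Balaban1983to89.B5Block118 (tstep)
open Summit.QuantumFields.BalabanUV.Beta.GAN24.DirichletBoxRegularity (Pdir)
open Summit.QuantumFields.BalabanUV.Beta.GAN24.DirichletBoxTrace (blockReg)
open Summit.QuantumFields.BalabanUV.Beta.GAN24.DirichletBoxTwoLevelCore (bdryPart normSq_exterior_density_le)
open Summit.QuantumFields.BalabanUV.Beta.GAN24.DirichletBoxWeightedTraces (trace_fwd_sum_le_weighted trace_bwd_sum_le_weighted
  nsq_bdryPart_le_fluxes)
open DirichletVertexEnergy (omegaV omegaV_pos omegaV_le_one)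
open DirichletVertexDistV (rV rV_le_n one_le_rV rV_add_tstep_le rV_sub_tstep_le rV_sub_unitVec_le le_inv_omegaV le_omegaV)

variable (n : ℕ) [NeZero n] (M : Fin 2 → ℕ) [hM : ∀ μ, NeZero (M μ)] (V : Finset ((Fin 2 → Bool) × Tor M))

/-! ## §1 The schedule -/

/-- the RAY LENGTH `ℓ(y) = max(1, ⌊r_V(y)/4⌋)`. [folklore] -/
def ell (y : Tor (fine n M)) : ℕ := max 1 (rV n M V y / 4)

/-- the weight on the first differences `ρ₁ = (18/n)·ω_V⁻¹`. [folklore] -/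
def rho1 (x : Tor (fine n M)) : ℝ := 18 / (n : ℝ) * (omegaV n M V (n - 1) x)⁻¹

/-- the weight on the second differences `ρ₂ = ((1+|V|)/n)·ω_V`. [folklore] -/
def rho2 (x : Tor (fine n M)) : ℝ := (1 + V.card) / (n : ℝ) * omegaV n M V (n - 1) x

omit [NeZero n] hM in
/-- `1 ≤ ℓ`. [folklore] -/
theorem one_le_ell (y : Tor (fine n M)) : 1 ≤ ell n M V y := le_max_left _ _

omit hM in
/-- `ℓ ≤ n`. [folklore] -/
theorem ell_le_n (y : Tor (fine n M)) : ell n M V y ≤ n := by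
  have := rV_le_n n M V y
  have := Nat.pos_of_ne_zero (NeZero.ne n)
  unfold ell; omega

omit [NeZero n] hM in
/-- `0 ≤ ρ₁`. [folklore] -/
theorem rho1_nonneg (x : Tor (fine n M)) : 0 ≤ rho1 n M V x := by
  have := omegaV_pos n M V (n - 1) x
  unfold rho1; positivity

omit [NeZero n] hM in
/-- `0 ≤ ρ₂`. [folklore] -/
theorem rho2_nonneg (x : Tor (fine n M)) : 0 ≤ rho2 n M V x := by
  have := omegaV_pos n M V (n - 1) x
  unfold rho2; positivity

/-- **schedule, first differences**: if `r_V(x) ≤ r_V(y) + ℓ(y)` then `2/ℓ(y) ≤ ρ₁(x)`. [folklore] -/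
theorem schedule_one {y x : Tor (fine n M)} (h : rV n M V x ≤ rV n M V y + ell n M V y) : 2 / (ell n M V y : ℝ) ≤ rho1 n M V x := by
  have hn : (0 : ℝ) < n := by exact_mod_cast Nat.pos_of_ne_zero (NeZero.ne n)
  have hrx : (0 : ℝ) < rV n M V x := by exact_mod_cast one_le_rV n M V x
  have hℓ : (0 : ℝ) < ell n M V y := by exact_mod_cast one_le_ell n M V y
  -- integer part: `r_V(x) ≤ 9ℓ(y)`
  have hint : rV n M V x ≤ 9 * ell n M V y := by unfold ell at h ⊢; omega
  have h1 : (2 : ℝ) / ell n M V y ≤ 18 / rV n M V x := by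
    rw [div_le_div_iff₀ hℓ hrx]
    have : (rV n M V x : ℝ) ≤ 9 * ell n M V y := by exact_mod_cast hint
    linarith
  have h2 : (18 : ℝ) / rV n M V x = 18 / (n : ℝ) * ((n : ℝ) / rV n M V x) := by field_simp
  rw [rho1]
  calc (2 : ℝ) / ell n M V y ≤ 18 / rV n M V x := h1
    _ = 18 / (n : ℝ) * ((n : ℝ) / rV n M V x) := h2
    _ ≤ 18 / (n : ℝ) * (omegaV n M V (n - 1) x)⁻¹ := mul_le_mul_of_nonneg_left (le_inv_omegaV n M V x) (by positivity)

/-- **schedule, second differences**: if `2 ≤ ℓ(y)` and `r_V(y) ≤ r_V(x) + (ℓ(y) − 2)` then `2ℓ(y)/n² ≤ ρ₂(x)` (`2 ≤ n`, `M_ν ≥ 2`). [folklore] -/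
theorem schedule_two (hn : 2 ≤ n) (hM2 : ∀ ν, 2 ≤ M ν) {y x : Tor (fine n M)} (hℓ : 2 ≤ ell n M V y)
    (h : rV n M V y ≤ rV n M V x + (ell n M V y - 2)) : 2 * (ell n M V y : ℝ) / (n : ℝ) ^ 2 ≤ rho2 n M V x := by
  have hn0 : (0 : ℝ) < n := by exact_mod_cast Nat.pos_of_ne_zero (NeZero.ne n)
  have hV : (0 : ℝ) < 1 + V.card := by positivity
  have hint : 2 * ell n M V y ≤ rV n M V x := by unfold ell at h hℓ ⊢; omega
  have h1 : 2 * (ell n M V y : ℝ) / (n : ℝ) ^ 2 ≤ (rV n M V x : ℝ) / (n : ℝ) ^ 2 :=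
    div_le_div_of_nonneg_right (by exact_mod_cast hint) (by positivity)
  have h2 : (rV n M V x : ℝ) / (n : ℝ) ^ 2 = (1 + V.card) / (n : ℝ) * ((rV n M V x : ℝ) / ((1 + V.card) * n)) := by
    field_simp
  rw [rho2]
  calc _ ≤ _ := h1
    _ = _ := h2
    _ ≤ (1 + V.card) / (n : ℝ) * omegaV n M V (n - 1) x := mul_le_mul_of_nonneg_left (le_omegaV n M V hn hM2 x) (by positivity)

variable (S : Tor M → Prop) [DecidablePred S]

/-- **THE FLUX OF ONE DIRECTION FROM WEIGHTED SUMS**: for `u` vanishing off `Ω = blockReg n M S` (`2 ≤ n`, `M_ν ≥ 2`),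
`Σ_{fwd bdry}‖n·u‖² + Σ_{bwd bdry}‖n·u‖² ≤ (36/n)·Σ_x ω_V⁻¹|(∂_μu)(x)|² + (2(1+|V|)/n)·Σ_{x∈Ω} ω_V|(∂ᴴ_μ∂_μu)(x)|²`. [folklore] -/
theorem flux_le (hn : 2 ≤ n) (hM2 : ∀ ν, 2 ≤ M ν) (μ : Fin 2) {u : Tor (fine n M) → ℂ} (hu : ∀ x, ¬ blockReg n M S x → u x = 0) :
    ∑ y ∈ univ.filter (fun y : Tor (fine n M) => blockReg n M S y ∧ ¬ blockReg n M S (y - unitVec (fine n M) μ)), ‖(n : ℂ) * u y‖ ^ 2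
      + ∑ y ∈ univ.filter (fun y : Tor (fine n M) => blockReg n M S y ∧ ¬ blockReg n M S (y + unitVec (fine n M) μ)), ‖(n : ℂ) * u y‖ ^ 2
      ≤ 36 / (n : ℝ) * ∑ x, (omegaV n M V (n - 1) x)⁻¹ * ‖(sdiff (fine n M) (n : ℂ) μ *ᵥ u) x‖ ^ 2
        + 2 * (1 + V.card) / (n : ℝ) * ∑ x ∈ univ.filter (blockReg n M S), omegaV n M V (n - 1) x * ‖(Pdir (fine n M) (n : ℂ) μ *ᵥ u) x‖ ^ 2 := by
  -- the schedule hypotheses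
  have hf₁ : ∀ y, blockReg n M S y → ¬ blockReg n M S (y - unitVec (fine n M) μ) → ∀ j, j < ell n M V y →
      2 / (ell n M V y : ℝ) ≤ rho1 n M V (y - unitVec (fine n M) μ + tstep (fine n M) μ j) := by
    intro y _ _ j hj
    refine schedule_one n M V ?_
    have h1 := (rV_sub_unitVec_le n M V μ y).1
    have h2 := (rV_add_tstep_le n M V μ (y - unitVec (fine n M) μ) j).1
    omega
  have hf₂ : ∀ y, blockReg n M S y → ¬ blockReg n M S (y - unitVec (fine n M) μ) → ∀ i, i + 1 < ell n M V y →
      2 * (ell n M V y : ℝ) / (n : ℝ) ^ 2 ≤ rho2 n M V (y + tstep (fine n M) μ i) := by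
    intro y _ _ i hi
    refine schedule_two n M V hn hM2 (by omega) ?_
    have h2 := (rV_add_tstep_le n M V μ y i).2
    omega
  have hb₁ : ∀ y, blockReg n M S y → ¬ blockReg n M S (y + unitVec (fine n M) μ) → ∀ j, j < ell n M V y →
      2 / (ell n M V y : ℝ) ≤ rho1 n M V (y - tstep (fine n M) μ j) := by
    intro y _ _ j hj
    refine schedule_one n M V ?_
    have h2 := (rV_sub_tstep_le n M V μ y j).1
    omega
  have hb₂ : ∀ y, blockReg n M S y → ¬ blockReg n M S (y + unitVec (fine n M) μ) → ∀ i, i + 1 < ell n M V y →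
      2 * (ell n M V y : ℝ) / (n : ℝ) ^ 2 ≤ rho2 n M V (y - tstep (fine n M) μ i) := by
    intro y _ _ i hi
    refine schedule_two n M V hn hM2 (by omega) ?_
    have h2 := (rV_sub_tstep_le n M V μ y i).2
    omega
  have hF := trace_fwd_sum_le_weighted n M S μ u hu (ell n M V) (one_le_ell n M V) (ell_le_n n M V) (rho1 n M V) (rho2 n M V)
    (rho1_nonneg n M V) (rho2_nonneg n M V) hf₁ hf₂
  have hB := trace_bwd_sum_le_weighted n M S μ u hu (ell n M V) (one_le_ell n M V) (ell_le_n n M V) (rho1 n M V) (rho2 n M V)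
    (rho1_nonneg n M V) (rho2_nonneg n M V) hb₁ hb₂
  -- the weighted sums
  have e1 : ∑ x, rho1 n M V x * ‖(sdiff (fine n M) (n : ℂ) μ *ᵥ u) x‖ ^ 2
      = 18 / (n : ℝ) * ∑ x, (omegaV n M V (n - 1) x)⁻¹ * ‖(sdiff (fine n M) (n : ℂ) μ *ᵥ u) x‖ ^ 2 := by
    rw [mul_sum]; refine sum_congr rfl fun x _ => ?_; rw [rho1]; ring
  have e2 : ∑ x ∈ univ.filter (blockReg n M S), rho2 n M V x * ‖(Pdir (fine n M) (n : ℂ) μ *ᵥ u) x‖ ^ 2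
      = (1 + V.card) / (n : ℝ) * ∑ x ∈ univ.filter (blockReg n M S), omegaV n M V (n - 1) x * ‖(Pdir (fine n M) (n : ℂ) μ *ᵥ u) x‖ ^ 2 := by
    rw [mul_sum]; refine sum_congr rfl fun x _ => ?_; rw [rho2]; ring
  rw [e1, e2] at hF hB
  have e3 : 36 / (n : ℝ) * ∑ x, (omegaV n M V (n - 1) x)⁻¹ * ‖(sdiff (fine n M) (n : ℂ) μ *ᵥ u) x‖ ^ 2
      + 2 * (1 + V.card) / (n : ℝ) * ∑ x ∈ univ.filter (blockReg n M S), omegaV n M V (n - 1) x * ‖(Pdir (fine n M) (n : ℂ) μ *ᵥ u) x‖ ^ 2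
      = 2 * (18 / (n : ℝ) * ∑ x, (omegaV n M V (n - 1) x)⁻¹ * ‖(sdiff (fine n M) (n : ℂ) μ *ᵥ u) x‖ ^ 2
        + (1 + V.card) / (n : ℝ) * ∑ x ∈ univ.filter (blockReg n M S), omegaV n M V (n - 1) x * ‖(Pdir (fine n M) (n : ℂ) μ *ᵥ u) x‖ ^ 2) := by
    ring
  rw [e3]
  linarith

/-! ## §2 The coarse flux binder (Φ), field form -/

/-- **(Φ), FIELD FORM**: for `u` vanishing off `Ω = blockReg n M S` (`2 ≤ n`, `M_ν ≥ 2`),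
`Σ_μ nsq(bdryPart(∂_μu)) ≤ (36/n)·Σ_μ Σ_y ω_V⁻¹|∂_μu|² + (2(1+|V|)/n)·Σ_μ Σ_{x∈Ω} ω_V|∂ᴴ_μ∂_μu|²`. [folklore] -/
theorem bdry_sum_le (hn : 2 ≤ n) (hM2 : ∀ ν, 2 ≤ M ν) {u : Tor (fine n M) → ℂ} (hu : ∀ x, ¬ blockReg n M S x → u x = 0) :
    ∑ μ, nsq (bdryPart n M (blockReg n M S) μ (sdiff (fine n M) (n : ℂ) μ *ᵥ u))
      ≤ 36 / (n : ℝ) * ∑ μ, ∑ x, (omegaV n M V (n - 1) x)⁻¹ * ‖(sdiff (fine n M) (n : ℂ) μ *ᵥ u) x‖ ^ 2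
        + 2 * (1 + V.card) / (n : ℝ) *
          ∑ μ, ∑ x ∈ univ.filter (blockReg n M S), omegaV n M V (n - 1) x * ‖(Pdir (fine n M) (n : ℂ) μ *ᵥ u) x‖ ^ 2 := by
  rw [mul_sum, mul_sum, ← sum_add_distrib]
  refine sum_le_sum fun μ _ => ?_
  have h0 := nsq_bdryPart_le_fluxes n M S μ hu
  have h1 := flux_le n M V S hn hM2 μ hu
  exact h0.trans ((add_comm _ _).le.trans h1)

/-! ## §3 The fine flux binder (Φ′), field form, at a refined level `R·N` -/

section Fine

variable (N R : ℕ) [NeZero N] [NeZero R]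

/-- **the exterior density is carried by the boundary fluxes**: for `v` vanishing off `Ω′ = blockReg (R·N) M S`,
`Σ_{x∉Ω′}|(∂′ᴴ_μ∂′_μv)(x)|² ≤ 2(RN)²·(Σ_{fwd bdry}‖RN·v‖² + Σ_{bwd bdry}‖RN·v‖²)`. [folklore] -/
theorem exterior_le_fluxes (μ : Fin 2) {v : Tor (fine (R * N) M) → ℂ} (hv : ∀ x, ¬ blockReg (R * N) M S x → v x = 0) :
    ∑ x ∈ univ.filter (fun x => ¬ blockReg (R * N) M S x), ‖(Pdir (fine (R * N) M) ((R * N : ℕ) : ℂ) μ *ᵥ v) x‖ ^ 2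
      ≤ 2 * ((R * N : ℕ) : ℝ) ^ 2 *
        (∑ y ∈ univ.filter (fun y : Tor (fine (R * N) M) => blockReg (R * N) M S y ∧ ¬ blockReg (R * N) M S (y - unitVec (fine (R * N) M) μ)),
            ‖((R * N : ℕ) : ℂ) * v y‖ ^ 2
          + ∑ y ∈ univ.filter (fun y : Tor (fine (R * N) M) => blockReg (R * N) M S y ∧ ¬ blockReg (R * N) M S (y + unitVec (fine (R * N) M) μ)),
            ‖((R * N : ℕ) : ℂ) * v y‖ ^ 2) := by
  have hc0 : (0 : ℝ) < ((R * N : ℕ) : ℝ) := by exact_mod_cast Nat.pos_of_ne_zero (NeZero.ne (R * N))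
  have hpt := normSq_exterior_density_le N R M S μ hv
  set Ω' := blockReg (R * N) M S with hΩ'
  set e := unitVec (fine (R * N) M) μ with he
  set c : ℝ := ((R * N : ℕ) : ℝ) with hc
  set T : Tor (fine (R * N) M) → ℝ := fun y => ‖(((R * N : ℕ) : ℂ)) * v y‖ ^ 2 with hT
  have hTv : ∀ y, ‖v y‖ ^ 2 = (c ^ 2)⁻¹ * T y := by
    intro y
    show ‖v y‖ ^ 2 = (c ^ 2)⁻¹ * ‖(((R * N : ℕ) : ℂ)) * v y‖ ^ 2
    rw [norm_mul, Complex.norm_natCast, mul_pow, ← hc, ← mul_assoc, inv_mul_cancel₀ (by positivity), one_mul]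
  have hF : ∑ x, (if Ω' x then (0 : ℝ) else ‖v (x + e)‖ ^ 2)
      = (c ^ 2)⁻¹ * ∑ y ∈ univ.filter (fun y => Ω' y ∧ ¬ Ω' (y - e)), T y := by
    rw [Finset.mul_sum, Finset.sum_filter]
    refine Fintype.sum_equiv (Equiv.addRight e) _ _ (fun x => ?_)
    simp only [Equiv.coe_addRight, add_sub_cancel_right]
    by_cases hx : Ω' x
    · rw [if_pos hx, if_neg (fun h => h.2 hx)]
    · rw [if_neg hx]
      by_cases hxe : Ω' (x + e)
      · rw [if_pos ⟨hxe, hx⟩, hTv]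
      · rw [if_neg (fun h => hxe h.1), hv _ hxe, norm_zero, zero_pow two_ne_zero]
  have hB : ∑ x, (if Ω' x then (0 : ℝ) else ‖v (x - e)‖ ^ 2)
      = (c ^ 2)⁻¹ * ∑ y ∈ univ.filter (fun y => Ω' y ∧ ¬ Ω' (y + e)), T y := by
    rw [Finset.mul_sum, Finset.sum_filter]
    refine Fintype.sum_equiv (Equiv.subRight e) _ _ (fun x => ?_)
    simp only [Equiv.subRight_apply, sub_add_cancel]
    by_cases hx : Ω' x
    · rw [if_pos hx, if_neg (fun h => h.2 hx)]
    · rw [if_neg hx]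
      by_cases hxe : Ω' (x - e)
      · rw [if_pos ⟨hxe, hx⟩, hTv]
      · rw [if_neg (fun h => hxe h.1), hv _ hxe, norm_zero, zero_pow two_ne_zero]
  -- the exterior sum as a sum of the truncated density
  have hlhs : ∑ x ∈ univ.filter (fun x => ¬ Ω' x), ‖(Pdir (fine (R * N) M) ((R * N : ℕ) : ℂ) μ *ᵥ v) x‖ ^ 2
      = ∑ x, ‖(if Ω' x then 0 else (Pdir (fine (R * N) M) ((R * N : ℕ) : ℂ) μ *ᵥ v) x)‖ ^ 2 := by
    rw [Finset.sum_filter]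
    refine sum_congr rfl fun x _ => ?_
    split_ifs <;> simp
  rw [hlhs]
  calc ∑ x, ‖(if Ω' x then 0 else (Pdir (fine (R * N) M) ((R * N : ℕ) : ℂ) μ *ᵥ v) x)‖ ^ 2
      ≤ ∑ x, 2 * c ^ 4 * ((if Ω' x then 0 else ‖v (x + e)‖ ^ 2) + (if Ω' x then 0 else ‖v (x - e)‖ ^ 2)) :=
        Finset.sum_le_sum fun x _ => hpt x
    _ = 2 * c ^ 4 * ((c ^ 2)⁻¹ * ∑ y ∈ univ.filter (fun y => Ω' y ∧ ¬ Ω' (y - e)), T y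
          + (c ^ 2)⁻¹ * ∑ y ∈ univ.filter (fun y => Ω' y ∧ ¬ Ω' (y + e)), T y) := by
        rw [← Finset.mul_sum, Finset.sum_add_distrib, hF, hB]
    _ = 2 * c ^ 2 * (∑ y ∈ univ.filter (fun y => Ω' y ∧ ¬ Ω' (y - e)), T y + ∑ y ∈ univ.filter (fun y => Ω' y ∧ ¬ Ω' (y + e)), T y) := by
        field_simp

/-- **(Φ′), FIELD FORM, at the refined level `n′ = R·N`**: for `v` vanishing off `Ω′` (`2 ≤ RN`, `M_ν ≥ 2`) and the weight `ω′_V` of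
level `RN`: `Σ_μ Σ_{x∉Ω′}|∂′ᴴ_μ∂′_μv|² ≤ 4RN·(18·Σ_μΣ_x ω′_V⁻¹|∂′_μv|² + (1+|V|)·Σ_μΣ_{x∈Ω′} ω′_V|∂′ᴴ_μ∂′_μv|²)`. [folklore] -/
theorem exterior_sum_le (hn : 2 ≤ R * N) (hM2 : ∀ ν, 2 ≤ M ν) {v : Tor (fine (R * N) M) → ℂ}
    (hv : ∀ x, ¬ blockReg (R * N) M S x → v x = 0) :
    ∑ μ, ∑ x ∈ univ.filter (fun x => ¬ blockReg (R * N) M S x), ‖(Pdir (fine (R * N) M) ((R * N : ℕ) : ℂ) μ *ᵥ v) x‖ ^ 2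
      ≤ 4 * ((R * N : ℕ) : ℝ) *
        (18 * ∑ μ, ∑ x, (omegaV (R * N) M V (R * N - 1) x)⁻¹ * ‖(sdiff (fine (R * N) M) ((R * N : ℕ) : ℂ) μ *ᵥ v) x‖ ^ 2
          + (1 + V.card) * ∑ μ, ∑ x ∈ univ.filter (blockReg (R * N) M S),
              omegaV (R * N) M V (R * N - 1) x * ‖(Pdir (fine (R * N) M) ((R * N : ℕ) : ℂ) μ *ᵥ v) x‖ ^ 2) := by
  have hc0 : (0 : ℝ) < ((R * N : ℕ) : ℝ) := by exact_mod_cast Nat.pos_of_ne_zero (NeZero.ne (R * N))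
  set A : Fin 2 → ℝ := fun μ => ∑ x, (omegaV (R * N) M V (R * N - 1) x)⁻¹ * ‖(sdiff (fine (R * N) M) ((R * N : ℕ) : ℂ) μ *ᵥ v) x‖ ^ 2
    with hA
  set B : Fin 2 → ℝ := fun μ => ∑ x ∈ univ.filter (blockReg (R * N) M S),
    omegaV (R * N) M V (R * N - 1) x * ‖(Pdir (fine (R * N) M) ((R * N : ℕ) : ℂ) μ *ᵥ v) x‖ ^ 2 with hB
  have hdir : ∀ μ, ∑ x ∈ univ.filter (fun x => ¬ blockReg (R * N) M S x), ‖(Pdir (fine (R * N) M) ((R * N : ℕ) : ℂ) μ *ᵥ v) x‖ ^ 2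
      ≤ 4 * ((R * N : ℕ) : ℝ) * (18 * A μ + (1 + V.card) * B μ) := by
    intro μ
    have h0 := exterior_le_fluxes M S N R μ hv
    have h1 := flux_le (R * N) M V S hn hM2 μ hv
    refine h0.trans ?_
    have e : 2 * ((R * N : ℕ) : ℝ) ^ 2 * (36 / ((R * N : ℕ) : ℝ) * A μ + 2 * (1 + V.card) / ((R * N : ℕ) : ℝ) * B μ)
        = 4 * ((R * N : ℕ) : ℝ) * (18 * A μ + (1 + V.card) * B μ) := by
      field_simp
      ring
    rw [← e]
    exact mul_le_mul_of_nonneg_left h1 (by positivity)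
  calc _ ≤ ∑ μ, 4 * ((R * N : ℕ) : ℝ) * (18 * A μ + (1 + V.card) * B μ) := sum_le_sum fun μ _ => hdir μ
    _ = 4 * ((R * N : ℕ) : ℝ) * (18 * ∑ μ, A μ + (1 + V.card) * ∑ μ, B μ) := by
        rw [Fin.sum_univ_two, Fin.sum_univ_two, Fin.sum_univ_two]; ring

end Fine

end Summit.QuantumFields.BalabanUV.Beta.GAN24.DirichletVertexFlux

end
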